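import Mathlib
import Summits.Ventures.HodgeRepro2.T5UnitaryThreeHecke

/-!
# Units of a local ring read in its fraction field: the unit-sum lemma

Blind cell `pub-hodge-repro2`, seat p8 (gen 13), Tier-5 kernel support.  The inert-place files
speak of `R`-integrality inside the field `E` (`IsLocalization.IsInteger`).  This file packages
the UNITS of `R` in that language — `IsRUnit R x := x` integral, non-zero, with integral inverse
(`isRUnit_algebraMap_iff`: exactly the units of `R`) — and the unit-sum lemma of the LOCAL ring `R`
read in `E`: a sum of integral elements is a unit only if one summand is
(`isUnit_or_isUnit_of_add`, `isRUnit_of_sum_three`), a product only if both factors are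
(`isRUnit_of_mul_left`), and the star of a unit is a unit (`IsRUnit.star`).  Used by
`T5HermitianIsotropicLattice` (a primitive vector pairs to a unit).

README §8(d): uses an L-value-free non-vanishing device: NO.
-/

namespace Summit.Ventures.HodgeRepro2.T5IntegralUnits

open IsLocalization

section UnitSum

variable {R E : Type*} [CommRing R] [IsLocalRing R] [Field E] [Algebra R E] [IsFractionRing R E]

/-- A unit of `R` read in `E`: integral, non-zero, with integral inverse. -/
def IsRUnit (R : Type*) {E : Type*} [CommRing R] [Field E] [Algebra R E] (x : E) : Prop :=
  IsInteger R x ∧ x ≠ 0 ∧ IsInteger R x⁻¹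

/-- `algebraMap r` is an `R`-unit iff `r` is a unit. -/
theorem isRUnit_algebraMap_iff (r : R) : IsRUnit R (algebraMap R E r) ↔ IsUnit r := by
  constructor
  · rintro ⟨-, hne, hinv⟩
    exact T5UnitaryThreeCorner.isUnit_of_isInteger_inv hne hinv
  · intro hr
    refine ⟨⟨r, rfl⟩, (map_ne_zero_iff _ (IsFractionRing.injective R E)).mpr hr.ne_zero,
      T5UnitaryThreeCorner.isInteger_inv_of_isUnit hr⟩

/-- **The unit-sum lemma in `E`**: if `x, y` are integral and `x + y` is a unit, then `x` or `y`
is a unit. -/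
theorem isUnit_or_isUnit_of_add {x y : E} (hx : IsInteger R x) (hy : IsInteger R y)
    (h : IsRUnit R (x + y)) : IsRUnit R x ∨ IsRUnit R y := by
  obtain ⟨a, rfl⟩ := hx
  obtain ⟨b, rfl⟩ := hy
  rw [← map_add, isRUnit_algebraMap_iff] at h
  rcases IsLocalRing.isUnit_or_isUnit_of_isUnit_add h with ha | hb
  · exact Or.inl ((isRUnit_algebraMap_iff a).mpr ha)
  · exact Or.inr ((isRUnit_algebraMap_iff b).mpr hb)

/-- A product of integral elements is a unit only if both factors are. -/
theorem isRUnit_of_mul_left {x y : E} (hx : IsInteger R x) (hy : IsInteger R y)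
    (h : IsRUnit R (x * y)) : IsRUnit R x := by
  obtain ⟨a, rfl⟩ := hx
  obtain ⟨b, rfl⟩ := hy
  rw [← map_mul, isRUnit_algebraMap_iff] at h
  exact (isRUnit_algebraMap_iff a).mpr (isUnit_of_mul_isUnit_left h)

/-- The unit-sum lemma for three summands. -/
theorem isRUnit_of_sum_three {f : Fin 3 → E} (hf : ∀ i, IsInteger R (f i))
    (h : IsRUnit R (∑ i, f i)) : ∃ i, IsRUnit R (f i) := by
  rw [Fin.sum_univ_three] at h
  rcases isUnit_or_isUnit_of_add (isInteger_add (hf 0) (hf 1)) (hf 2) h with h01 | h2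
  · rcases isUnit_or_isUnit_of_add (hf 0) (hf 1) h01 with h0 | h1
    · exact ⟨0, h0⟩
    · exact ⟨1, h1⟩
  · exact ⟨2, h2⟩

omit [IsLocalRing R] [IsFractionRing R E] in
/-- The star of a unit is a unit (star preserving integrality). -/
theorem IsRUnit.star [StarRing E] (hstar : ∀ x : E, IsInteger R x → IsInteger R (star x)) {x : E}
    (h : IsRUnit R x) : IsRUnit R (star x) := by
  obtain ⟨h1, h2, h3⟩ := h
  refine ⟨hstar x h1, star_ne_zero.mpr h2, ?_⟩
  rw [← star_inv₀]
  exact hstar _ h3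

end UnitSum

end Summit.Ventures.HodgeRepro2.T5IntegralUnits
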